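import Summits.HodgeConjecture.HodgeConjecture.Theorems.Ring2HypothesesCMPivot
import Summits.HodgeConjecture.HodgeConjecture.Theorems.Ring2HypothesesWeilComponentsGerm
import Summits.HodgeConjecture.HodgeConjecture.Theorems.Ring2HypothesesWeilComponentsCMGerm
import Summits.HodgeConjecture.HodgeConjecture.Theorems.Ring2HypothesesCMPowerTransport
import Summits.HodgeConjecture.HodgeConjecture.Theorems.Ring2TransportLocalGermCMField
import Summits.HodgeConjecture.HodgeConjecture.Theorems.Ring2TransportDivisorGeneratedAnchors
import Summits.HodgeConjecture.HodgeConjecture.Theorems.PadicSemiregularLiftHodgeAbelianVarietiesCMPivotAllFibres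
import Summits.HodgeConjecture.HodgeConjecture.Theorems.PadicSemiregularLiftHodgeAbelianVarietiesCMPivotConverseHolds
import HarnessLib

/-!
# Ring 2 — hypotheses layer, part XXVI: GERM DOMINATION — the CM-pivot germ `LocalVHCAtCM` implies every CM-anchored Weil germ of the axis, and what that does to the `HC_CM` column

HONEST FRAMING: research route conditional on HC_CM; not a corollary; Q11.4-sentence-2 already refuted in dim ≥ 3.

Cell `pub-hodge-ring2`, seat `pub-hodge-ring2-typer2`, gen 15. `HC_CM` is ALWAYS the binder
`(hCM : Theses.RankFourFaces.CMAbelianHodge)` (stmt-HodgeConjecture-3052), never an axiom, never cited as known;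
`HC_AV` is `Theses.PadicSemiregularLift.HodgeAbelianVarieties` (stmt-1333). Nothing in this file proves a case of the
Hodge conjecture: every theorem is an implication between NAMED typed inputs already in the tree. No new definition,
no new `@[conjecture]` node.

## What this part adds (one bookkeeping edge missing from the axis, and its corollary rows)

The axis carries FIVE typed "local variational Hodge germ at a CM fibre" inputs, filed by three seats in two typings:

* the CM-PIVOT germ `Ring2.Hypotheses.LocalVHCAtCM` (part II; verbatim child 3 of crux `HodgeAbelianVarieties`, line
  `cm-pivot`): ANY smooth projective family `f : 𝒳 ⟶ S` (relative dimension `m`, `𝒳`, `S` quasi-projective, `S` smooth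
  irreducible), ANY degree `2p`, a global class `G` rational `(p,p)` on the ABELIAN-PRESENTED fibres, a CM fibre
  `A₀ ≅ 𝒳_{s₀}` in the EIGENVALUE typing `IsCM[A₀]` on which `G|` is algebraic ⟹ `G|_{𝒳_t}` algebraic for `t` near `s₀`;
* the WEIL-COLUMN germs `Ring2Transport.LocalWeilVHCAtCMQuadratic`, `Ring2Transport.LocalWeilVHCAtCMField` (transport
  seat) and `LocalWeilVHCAtCMComponent n d δ`, `LocalWeilVHCAtCMComponentCM R e₀ k δ` (parts XI-A / XI-A-CM): the SAME
  conclusion, asked only of WEIL families (relative dimension `2n`, resp. `e·m`, `2k·e₀`; middle degree; Weil charts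
  on every fibre), with `G` rational `(p,p)` on EVERY fibre and the anchor fibre CM in the SUBALGEBRA typing
  `Milne1999.IsOfCMType A₀` (`cmAnchor`, `cmAnchorOfDim`).

Until now the tree had NO edge between the two typings. This part proves the domination

  `LocalVHCAtCM ⟹ LocalWeilVHCAtCMQuadratic ∧ LocalWeilVHCAtCMField ∧ (∀ n d δ, LocalWeilVHCAtCMComponent n d δ)
     ∧ (∀ R e₀ k δ, LocalWeilVHCAtCMComponentCM R e₀ k δ)`            (`weilGerms_of_localVHCAtCM`)

from ONE master lemma `germ_of_localVHCAtCM` (the CM-pivot germ specialised to a CM-presented anchor fibre in the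
subalgebra typing and to fibrewise Hodge-ness on all fibres). The two non-trivial conversions are TREE THEOREMS used by
name: the converse CM-typing bridge `Theorems.HodgeAbelianVarieties.CMPivot.stub_isCM_of_cmSubalgebra`
(`IsOfCMType A₀ → IsCM[A₀]`, Mumford §19 Thm. 3 / §22, landed p141407/p141224/p140966 and assembled unconditionally in
`…CMPivotConverseHolds`) and the abelian-presented ⟸ all-fibres Hodge-ness transport
`Cruxes.HodgeAbelianVarieties.CMPivot.AllFibres.localVHCAtCMAll_of_localVHCAtCM` (iso-transport of rationality and
Hodge type, `dim B = m` from the fibre inclusion). The Weil charts are simply forgotten. There is NO edge back in the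
tree (the Weil germs say nothing about non-Weil families or other degrees), and none is claimed.

## Corollary rows (each a one-liner over existing rows; the germ leaf is now the CM-pivot node)

| row | statement | `HC_CM` |
|---|---|---|
| G1 | `CMPowerPointedWeilFamiliesQuadratic ∧ LocalVHCAtCM ⟹ R∞` (`WeilClassesImaginaryQuadratic`) | none (Tate at the CM-power anchor; part IX T2) |
| G1′ | `DivisorGeneratedCMPointedWeilFamiliesQuadratic ∧ LocalVHCAtCM ⟹ R∞` | none (transport §3) |
| G2 | `DivisorGeneratedCMPointedWeilFamiliesCMField ∧ LocalVHCAtCM ⟹ W∞` (`WeilClassesCMField`) | none |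
| G2′ | `HC_CM ∧ CMPointedWeilFamiliesCMField ∧ LocalVHCAtCM ⟹ W∞` | nominal |
| G3 | `André1992 ∧ DivGen(quad) ∧ DivGen(CM) ∧ LocalVHCAtCM ⟹ HC_CM` | CONCLUSION |
| G4 | `André1992 ∧ DivGen(quad) ∧ DivGen(CM) ∧ CMAnchoredFamilies ∧ LocalVHCAtCM ⟹ HC_AV` | DISCHARGED |
| G5 | `HC_CM ∧ CMPointedWeilFamiliesComponent n d δ ∧ LocalVHCAtCM ⟹ WeilClassesComponent n d δ` (and CM-field twin) | nominal |
| G5′ | `DivisorGeneratedCMPointedWeilFamiliesComponent n d δ ∧ LocalVHCAtCM ⟹ WeilClassesComponent n d δ` (and twin); CM-power version | none |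
| G6 | `HC_CM ∧ CMPointedWeilFamiliesQuadratic ∧ LocalVHCAtCM ∧ MoonenZarhin ⟹ HC(dim ≤ 5)` | nominal |

HONEST COLUMN — what G3/G4 say about the `HC_CM` column of the CM-PIVOT row. Part II re-exported the tree's
`HC_CM ∧ CMAnchoredFamilies ∧ LocalVHCAtCM ⟹ HC_AV` and recorded `HC_CM` there as "load-bearing, not dominated by the
other inputs in the tree". With the transport seat's divisor-generated anchor leaves (THEOREMS IN PRINT for anchor-good
CM fields — Deligne LNM 900 §5, van Geemen 5.5; typed, OPEN as formal statements) and André 1992 (a Literature FACT,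
used as the hypothesis `hA`, direction Weil ⟹ CM only), the germ `LocalVHCAtCM` ALONE delivers R∞ and W∞ (G1′, G2),
hence `HC_CM` (G3): on the CM-pivot line `HC_CM` is DOMINATED by `LocalVHCAtCM` modulo {André, the two anchor leaves}
— the kernel form, for the CM-pivot germ, of the deform seat's remark (E) "a BLANKET variational input absorbs
`HC_CM`" (`Ring2DeformVariationalInputs`, module docstring). This SUPERSEDES the quoted sentence of part II §A; it does
not touch part II's theorems. CAVEAT carried verbatim from `Ring2Transport.HC_CM_of_andre_of_divisorGeneratedCMPointed_of_variational`:
the CM-field anchor leaf quantifies over ALL CM fields and print supplies its divisor-generation clause only for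
anchor-good fields (census j053089), so G3 is NOT a proof sketch of `HC_CM` from a germ alone. Content vs. print of the
germ itself: OPEN in every relative dimension `m ≥ 4`, `2 ≤ p ≤ m - 2` (tree `…CMPivotStubLocalVHCAtCM`); it is a case
of `HC_AV` only modulo "fibres near an abelian fibre are abelian" (GIT 6.14; tree
`…CMPivotSplit.localVHCAtCM_of_hodgeAbelianVarieties`), whereas the four Weil germs are cases of the summit outright
(`…_of_hodgeConjecture` in their home files) — consistent with the one-way edge proved here.

## References

* [MumfordAV1970] D. Mumford, *Abelian varieties* (1970), §19 Thm. 3 and Cor., §22 (CM type: the two typings).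
* [BuchweitzFlenner2003] R.-O. Buchweitz, H. Flenner, Compositio Math. 137 (2003), Thm. 5.1, Thm. 5.2 (output shape of the germ).
* [CharlesSchnell2014Notes] F. Charles, C. Schnell, *Notes on absolute Hodge classes*, Conj. 11.3.1, Prop. 11.3.11, Thm. 11.3.17, Thm. 11.5.11.
* [Deligne1982HodgeCycles] P. Deligne, LNM 900 (1982), §4 proof of Thm. 4.8, §5, Prop. 6.1.
* [Andre1992HodgeCM] Y. André, *Une remarque à propos des cycles de Hodge de type CM*, Sém. Théorie des Nombres Paris 1989–90, Progr. Math. 102 (1992), Théorème.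
* [vanGeemen1994HodgeAV] B. van Geemen, LNM 1594 (1994), Lemma 5.2, 5.5, Thm. 4.3. [Gordon1997] B. Gordon, Thm. 6.4, Prop. 9.4.1.
* [MoonenZarhin1999] B. Moonen, Yu. Zarhin, Duke Math. J. 98 (1999) (dim ≤ 5 reduction to Weil fourfolds).
* [Markman2025SurveySecant] E. Markman, arXiv:2509.23403 (UNREFEREED), Question 11.4, §12.
-/

set_option linter.dupNamespace false

noncomputable section

open CategoryTheory
open Literature.AlgebraicGeometry Literature.AlgebraicGeometry.Motives
open Literature.AlgebraicGeometry.HodgeTheory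
open Literature.AlgebraicTopology.SingularHomology
open Literature.AlgebraicGeometry.Deligne1982
open Literature.AlgebraicGeometry.VanGeemen1994
open Literature.AlgebraicGeometry.Milne1999 (IsOfCMType)
open Summit.HodgeConjecture.HodgeConjecture.WeilTypeLadder
open Summit.HodgeConjecture.HodgeConjecture.Theses

namespace Summit.HodgeConjecture.HodgeConjecture.Ring2.Hypotheses

/-! ### §1 The master lemma: the CM-pivot germ at a CM-presented fibre (subalgebra typing), Hodge-ness on all fibres -/

/-- **MASTER LEMMA — `LocalVHCAtCM` at a CM-PRESENTED anchor fibre.** For a smooth projective family `f : 𝒳 ⟶ S` of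
relative dimension `m` (`𝒳`, `S` quasi-projective, `S` smooth irreducible), a global class `W ∈ H^{2p}(𝒳(ℂ); ℂ)`
rational of type `(p,p)` on EVERY fibre, and a point `s₀` whose fibre is presented by an abelian variety of CM type
(`Milne1999.IsOfCMType`, the `CMAbelianHodge` typing) and on which `W|` is algebraic, the CM-pivot germ gives a
Euclidean-open `U ∋ s₀` of algebraic fibres. The two conversions are tree theorems: `stub_isCM_of_cmSubalgebra`
(subalgebra ⟹ eigenvalue CM typing, Mumford §19–§22) and `AllFibres.localVHCAtCMAll_of_localVHCAtCM` (Hodge-ness on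
all fibres ⟹ on abelian-presented fibres, by iso-transport); algebraicity moves along the presenting isomorphism by
`mem_algebraicClasses_map_iff_of_iso`. [cite: MumfordAV1970, §19 Thm. 3 and §22]
[cite: CharlesSchnell2014Notes, Conj. 11.3.1] -/
theorem germ_of_localVHCAtCM (hV : LocalVHCAtCM) {𝒳 S : SchemeOver ℂ} (f : 𝒳 ⟶ S) {m p : ℕ}
    (hf : IsSmoothProjectiveFamily f m) (h𝒳 : IsQuasiProjectiveOver 𝒳) (hS : IsQuasiProjectiveOver S)
    (hirr : IrreducibleSpace S.left) (hsm : AlgebraicGeometry.Smooth S.hom) (W : complexBetti 𝒳 (2 * p))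
    (hW : ∀ s : ComplexPoints S,
      IsRationalClass (complexBetti.map (fiberι f s) (2 * p) W) ∧
        IsOfHodgeType m (fiberOver f s) (2 * p) p p (complexBetti.map (fiberι f s) (2 * p) W))
    {s₀ : ComplexPoints S} (hcm : ∃ A₀ : AbelianVariety ℂ, Nonempty (A₀.X ≅ fiberOver f s₀) ∧ IsOfCMType A₀)
    (hs₀ : complexBetti.map (fiberι f s₀) (2 * p) W ∈ algebraicClasses (fiberOver f s₀) p) :
    ∃ U : Set (ComplexPoints S), IsOpen U ∧ s₀ ∈ U ∧
      ∀ t ∈ U, complexBetti.map (fiberι f t) (2 * p) W ∈ algebraicClasses (fiberOver f t) p := by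
  obtain ⟨A₀, ⟨i⟩, hA₀⟩ := hcm
  have halg : complexBetti.map (i.hom ≫ fiberι f s₀) (2 * p) W ∈ algebraicClasses A₀.X p := by
    rw [complexBetti.map_comp, CategoryTheory.comp_apply]
    exact (mem_algebraicClasses_map_iff_of_iso i).2 hs₀
  exact Cruxes.HodgeAbelianVarieties.CMPivot.AllFibres.localVHCAtCMAll_of_localVHCAtCM hV S 𝒳 f m p W s₀ A₀
    (i.hom ≫ fiberι f s₀) h𝒳 hS hsm hirr hf ⟨i, rfl⟩
    (Theorems.HodgeAbelianVarieties.CMPivot.stub_isCM_of_cmSubalgebra A₀ hA₀) halg hW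

/-! ### §2 The four Weil-column germ nodes (and the two schemas at any CM-presenting anchor) are dominated -/

/-- SCHEMA (quadratic components): the CM-pivot germ gives the δ-restricted local germ of part XI-A at EVERY anchor
predicate that presents the fibre by a CM abelian variety (`cmAnchor`, `divisorGeneratedCMAnchor`, `cmPowerAnchor`, …);
the Weil charts `HasWeilChartsOfDisc` are forgotten. [cite: MumfordAV1970, §22] [cite: BuchweitzFlenner2003, Thm. 5.1] -/
theorem localWeilVHCAtComponent_of_localVHCAtCM (hV : LocalVHCAtCM) (n d : ℕ) (δ : weilNormResidueGroup d)
    {anchor : (X : SchemeOver ℂ) → complexBetti X (2 * n) → Prop}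
    (hanc : ∀ (X : SchemeOver ℂ) (x : complexBetti X (2 * n)), anchor X x →
      ∃ A₀ : AbelianVariety ℂ, Nonempty (A₀.X ≅ X) ∧ IsOfCMType A₀) :
    LocalWeilVHCAtComponent n d δ anchor :=
  fun _ _ f hf h𝒳 hS hirrS hsm W hW _ _ hanch hs₀ ↦
    germ_of_localVHCAtCM hV f hf h𝒳 hS hirrS hsm W hW (hanc _ _ hanch) hs₀

/-- **`LocalVHCAtCM ⟹ LocalWeilVHCAtCMComponent n d δ`** for every component `(ℚ(√-d), 2n, δ)` (the CM anchor
`cmAnchor n` presents the fibre by a CM abelian variety; its dimension clause is not needed).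
[cite: MumfordAV1970, §22] [cite: BuchweitzFlenner2003, Thm. 5.1] -/
theorem localWeilVHCAtCMComponent_of_localVHCAtCM (hV : LocalVHCAtCM) (n d : ℕ) (δ : weilNormResidueGroup d) :
    LocalWeilVHCAtCMComponent n d δ :=
  localWeilVHCAtComponent_of_localVHCAtCM hV n d δ fun _ _ ⟨A₀, hi, _, hcm⟩ ↦ ⟨A₀, hi, hcm⟩

/-- **`LocalVHCAtCM ⟹ Ring2Transport.LocalWeilVHCAtCMQuadratic`** (the transport seat's unindexed germ, every
`n ≥ 2`, `d ≥ 1`; the unrestricted Weil charts are forgotten). [cite: MumfordAV1970, §22] [cite: BuchweitzFlenner2003, Thm. 5.1] -/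
theorem localWeilVHCAtCMQuadratic_of_localVHCAtCM (hV : LocalVHCAtCM) : Ring2Transport.LocalWeilVHCAtCMQuadratic :=
  fun _ _ _ _ _ _ f hf h𝒳 hS hirrS hsm W hW _ _ hanch hs₀ ↦
    germ_of_localVHCAtCM hV f hf h𝒳 hS hirrS hsm W hW (hanch.imp fun _ h ↦ ⟨h.1, h.2.2⟩) hs₀

/-- **`LocalVHCAtCM ⟹ Ring2Transport.LocalWeilVHCAtCMField`** (the transport seat's germ for a general CM field
`E = ℚ[x]/(P)`, relative dimension `e·m`, degree `2m`; the field data and the Weil charts are forgotten).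
[cite: MumfordAV1970, §22] [cite: Deligne1982HodgeCycles, §4 proof of Thm. 4.8] -/
theorem localWeilVHCAtCMField_of_localVHCAtCM (hV : LocalVHCAtCM) : Ring2Transport.LocalWeilVHCAtCMField :=
  fun _P _e _m _ _ _ _ _ _ _ _ _ f hf h𝒳 hS hirrS hsm W hW _ _ hanch hs₀ ↦
    germ_of_localVHCAtCM hV f hf h𝒳 hS hirrS hsm W hW (hanch.imp fun _ h ↦ ⟨h.1, h.2.2⟩) hs₀

section CMField

variable (R : Polynomial ℤ) [Fact (Irreducible (realPolyQ R))] (e₀ k : ℕ)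
  (δ : cmNormResidueGroup R)

/-- SCHEMA (CM-field components): the CM-pivot germ gives the δ-restricted local germ of part XI-A-CM at every
CM-presenting anchor (`cmAnchorOfDim`, `divisorGeneratedCMAnchorOfDim`, …); the charts `HasWeilChartsOfDiscCM` are
forgotten. [cite: MumfordAV1970, §22] [cite: Deligne1982HodgeCycles, §4 proof of Thm. 4.8 and §5] -/
theorem localWeilVHCAtComponentCM_of_localVHCAtCM (hV : LocalVHCAtCM)
    {anchor : (X : SchemeOver ℂ) → complexBetti X (2 * k) → Prop}
    (hanc : ∀ (X : SchemeOver ℂ) (x : complexBetti X (2 * k)), anchor X x →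
      ∃ A₀ : AbelianVariety ℂ, Nonempty (A₀.X ≅ X) ∧ IsOfCMType A₀) :
    LocalWeilVHCAtComponentCM R e₀ k δ anchor :=
  fun _ _ f hf h𝒳 hS hirrS hsm W hW _ _ hanch hs₀ ↦
    germ_of_localVHCAtCM hV f hf h𝒳 hS hirrS hsm W hW (hanc _ _ hanch) hs₀

/-- **`LocalVHCAtCM ⟹ LocalWeilVHCAtCMComponentCM R e₀ k δ`** for every CM-field component `(E, 2k, δ)`.
[cite: MumfordAV1970, §22] [cite: Deligne1982HodgeCycles, §5] -/
theorem localWeilVHCAtCMComponentCM_of_localVHCAtCM (hV : LocalVHCAtCM) : LocalWeilVHCAtCMComponentCM R e₀ k δ :=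
  localWeilVHCAtComponentCM_of_localVHCAtCM R e₀ k δ hV fun _ _ ⟨A₀, hi, _, hcm⟩ ↦ ⟨A₀, hi, hcm⟩

end CMField

/-- **GERM DOMINATION (summary)**: the single CM-pivot node `LocalVHCAtCM` implies all four CM-anchored Weil germ
nodes of the axis. One-way; no converse edge exists in the tree. [cite: MumfordAV1970, §22]
[cite: BuchweitzFlenner2003, Thm. 5.1] [cite: CharlesSchnell2014Notes, Conj. 11.3.1] -/
theorem weilGerms_of_localVHCAtCM (hV : LocalVHCAtCM) :
    Ring2Transport.LocalWeilVHCAtCMQuadratic ∧ Ring2Transport.LocalWeilVHCAtCMField ∧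
      (∀ (n d : ℕ) (δ : weilNormResidueGroup d), LocalWeilVHCAtCMComponent n d δ) ∧
      ∀ (R : Polynomial ℤ) [Fact (Irreducible (realPolyQ R))] (e₀ k : ℕ)
        (δ : cmNormResidueGroup R), LocalWeilVHCAtCMComponentCM R e₀ k δ :=
  ⟨localWeilVHCAtCMQuadratic_of_localVHCAtCM hV, localWeilVHCAtCMField_of_localVHCAtCM hV,
    localWeilVHCAtCMComponent_of_localVHCAtCM hV,
    fun R _ e₀ k δ ↦ localWeilVHCAtCMComponentCM_of_localVHCAtCM R e₀ k δ hV⟩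

/-! ### §3 Corollary rows: the class targets with the CM-pivot germ as the transport leaf -/

/-- **G1 — R∞ WITHOUT `HC_CM`**: CM-power-pointed Weil families (part IX; the anchor `E_Kⁿ⁺¹`-power fibre is algebraic
by Tate) and the CM-pivot germ give `WeilClassesImaginaryQuadratic` (part IX T2 with the germ leaf dominated).
[cite: vanGeemen1994HodgeAV, Thm. 4.3] [cite: CharlesSchnell2014Notes, Prop. 11.3.11 (proof)] -/
theorem HC_WeilClassesQuadratic_of_cmPowerPointed_of_localVHCAtCM
    (hP : CMPowerPointedWeilFamiliesQuadratic) (hV : LocalVHCAtCM) : WeilClassesImaginaryQuadratic :=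
  HC_WeilClassesQuadratic_of_cmPowerPointed_local hP (localWeilVHCAtCMQuadratic_of_localVHCAtCM hV)

/-- **G1′ — R∞ WITHOUT `HC_CM`** from the transport seat's divisor-generated CM-pointed families and the CM-pivot germ.
[cite: vanGeemen1994HodgeAV, 5.5] [cite: CharlesSchnell2014Notes, Prop. 11.3.11 (proof)] -/
theorem HC_WeilClassesQuadratic_of_divisorGeneratedCMPointed_of_localVHCAtCM
    (hP : Ring2Transport.DivisorGeneratedCMPointedWeilFamiliesQuadratic) (hV : LocalVHCAtCM) :
    WeilClassesImaginaryQuadratic :=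
  Ring2Transport.HC_WeilClassesQuadratic_of_divisorGeneratedCMPointed_local hP
    (localWeilVHCAtCMQuadratic_of_localVHCAtCM hV)

/-- **G2 — W∞ WITHOUT `HC_CM`**: divisor-generated CM-pointed Weil families for general CM fields (Deligne §5 members)
and the CM-pivot germ give `WeilClassesCMField`. [cite: Deligne1982HodgeCycles, §5]
[cite: CharlesSchnell2014Notes, Prop. 11.3.11 (proof)] -/
theorem HC_WeilClassesCMField_of_divisorGeneratedCMPointed_of_localVHCAtCM
    (hP : Ring2Transport.DivisorGeneratedCMPointedWeilFamiliesCMField) (hV : LocalVHCAtCM) : WeilClassesCMField :=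
  Ring2Transport.HC_WeilClassesCMField_of_divisorGeneratedCMPointed_local hP
    (localWeilVHCAtCMField_of_localVHCAtCM hV)

/-- **G2′ — W∞ from `HC_CM`**, CM-pointed Weil families (CM fields) and the CM-pivot germ (`HC_CM` nominal: G2 removes it
on the divisor-generated leaf). [cite: Deligne1982HodgeCycles, §4 proof of Thm. 4.8] -/
theorem HC_WeilClassesCMField_of_HC_CM_of_cmPointed_of_localVHCAtCM (hCM : Theses.RankFourFaces.CMAbelianHodge)
    (hP : Ring2Transport.CMPointedWeilFamiliesCMField) (hV : LocalVHCAtCM) : WeilClassesCMField :=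
  Ring2Transport.HC_WeilClassesCMField_of_HC_CM_local hCM hP (localWeilVHCAtCMField_of_localVHCAtCM hV)

/-- **G3 — `HC_CM` FROM the CM-pivot germ, granted André 1992 and the two divisor-generated anchor leaves.** André's
theorem (tree fact `Andre1992_hodgeClasses_cmAbelianVariety_mem_span_pullback_weilClasses`, direction Weil ⟹ CM, used
as the hypothesis `hA`) turns R∞ ∧ W∞ into `HC_CM` (tree `rankFourFaces_cmAbelianHodge_of_andre_of_rungs`); G1′ and G2
supply the rungs `HC_CM`-free. So on any line whose transport leaf is `LocalVHCAtCM`, `HC_CM` is DOMINATED modulo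
{André, the anchor leaves}. CAVEAT (verbatim from the transport seat): the CM-field anchor leaf quantifies over ALL CM
fields; print gives its divisor-generation clause for anchor-good fields only (census j053089) — NOT a proof sketch of
`HC_CM`. [cite: Andre1992HodgeCM, Théorème] [cite: Gordon1997, Thm. 6.4 and Prop. 9.4.1] -/
theorem HC_CM_of_andre_of_divisorGeneratedCMPointed_of_localVHCAtCM
    (hA : Andre1992_hodgeClasses_cmAbelianVariety_mem_span_pullback_weilClasses)
    (hP₂ : Ring2Transport.DivisorGeneratedCMPointedWeilFamiliesQuadratic)
    (hP₃ : Ring2Transport.DivisorGeneratedCMPointedWeilFamiliesCMField) (hV : LocalVHCAtCM) :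
    Theses.RankFourFaces.CMAbelianHodge :=
  rankFourFaces_cmAbelianHodge_of_andre_of_rungs hA
    (HC_WeilClassesQuadratic_of_divisorGeneratedCMPointed_of_localVHCAtCM hP₂ hV)
    (HC_WeilClassesCMField_of_divisorGeneratedCMPointed_of_localVHCAtCM hP₃ hV)

/-- **G4 — `HC_AV` on the CM-pivot line with `HC_CM` DISCHARGED**: part II's
`HC_CM ∧ CMAnchoredFamilies ∧ LocalVHCAtCM ⟹ HC_AV` with `hCM := G3`. Reading: granted André and the two anchor leaves,
the CM-pivot pricing of `HC_AV` is `CMAnchoredFamilies ∧ LocalVHCAtCM` and `HC_CM` is not load-bearing there — this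
supersedes the sentence "not dominated by the other inputs in the tree" of part II §A (its theorems are untouched).
[cite: Deligne1982HodgeCycles, Prop. 6.1] [cite: Andre1992HodgeCM, Théorème] [cite: CharlesSchnell2014Notes, Thm. 11.3.17] -/
theorem HC_AV_of_andre_of_divisorGeneratedCMPointed_of_cmAnchoredFamilies_of_localVHCAtCM
    (hA : Andre1992_hodgeClasses_cmAbelianVariety_mem_span_pullback_weilClasses)
    (hP₂ : Ring2Transport.DivisorGeneratedCMPointedWeilFamiliesQuadratic)
    (hP₃ : Ring2Transport.DivisorGeneratedCMPointedWeilFamiliesCMField)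
    (hMT : CMAnchoredFamilies) (hV : LocalVHCAtCM) : Theses.PadicSemiregularLift.HodgeAbelianVarieties :=
  hc_av_of_hc_cm_of_cmAnchoredFamilies_of_localVHCAtCM
    (HC_CM_of_andre_of_divisorGeneratedCMPointed_of_localVHCAtCM hA hP₂ hP₃ hV) hMT hV

/-- **G5 — row W1-loc with the CM-pivot germ**: `HC_CM ∧ CMPointedWeilFamiliesComponent n d δ ∧ LocalVHCAtCM ⟹
WeilClassesComponent n d δ` (`HC_CM` nominal). [cite: vanGeemen1994HodgeAV, Lemma 5.2] [cite: BuchweitzFlenner2003, Thm. 5.1] -/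
theorem weilClassesComponent_of_HC_CM_of_cmPointed_of_localVHCAtCM (hCM : Theses.RankFourFaces.CMAbelianHodge)
    {n d : ℕ} {δ : weilNormResidueGroup d} (hP : CMPointedWeilFamiliesComponent n d δ) (hV : LocalVHCAtCM) :
    WeilClassesComponent n d δ :=
  weilClassesComponent_of_HC_CM_local hCM hP (localWeilVHCAtCMComponent_of_localVHCAtCM hV n d δ)

/-- **G5′ — row W1′-loc with the CM-pivot germ, NO `HC_CM`**: divisor-generated CM-pointed δ-families.
[cite: vanGeemen1994HodgeAV, 5.5] [cite: BuchweitzFlenner2003, Thm. 5.1] -/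
theorem weilClassesComponent_of_divisorGeneratedCMPointed_of_localVHCAtCM {n d : ℕ} {δ : weilNormResidueGroup d}
    (hP : DivisorGeneratedCMPointedWeilFamiliesComponent n d δ) (hV : LocalVHCAtCM) : WeilClassesComponent n d δ :=
  weilClassesComponent_of_divisorGeneratedCMPointed_localCM hP (localWeilVHCAtCMComponent_of_localVHCAtCM hV n d δ)

/-- **G5″ — row W1‴-loc with the CM-pivot germ, NO `HC_CM`**: CM-power-pointed δ-families (part XI; anchor algebraic
by Tate, `cmPowerAnchor_valid`; CM-presented, `cmAnchor_of_cmPowerAnchor`). [cite: vanGeemen1994HodgeAV, Thm. 4.3 and 5.8]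
[cite: BuchweitzFlenner2003, Thm. 5.1] -/
theorem weilClassesComponent_of_cmPowerPointed_of_localVHCAtCM {n d : ℕ} {δ : weilNormResidueGroup d}
    (hP : CMPowerPointedWeilFamiliesComponent n d δ) (hV : LocalVHCAtCM) : WeilClassesComponent n d δ :=
  weilClassesComponent_of_pointed_of_local (cmPowerAnchor_valid n) hP
    (localWeilVHCAtComponent_of_localVHCAtCM hV n d δ fun _ _ h ↦
      (cmAnchor_of_cmPowerAnchor h).imp fun _ h' ↦ ⟨h'.1, h'.2.2⟩)

section CMFieldRows

variable {R : Polynomial ℤ} [Fact (Irreducible (realPolyQ R))] {e₀ k : ℕ}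
  {δ : cmNormResidueGroup R}

/-- **G5-CM — row W1-CM-loc with the CM-pivot germ** (`HC_CM` nominal). [cite: Deligne1982HodgeCycles, §4 proof of Thm. 4.8] -/
theorem weilClassesComponentCM_of_HC_CM_of_cmPointed_of_localVHCAtCM (hCM : Theses.RankFourFaces.CMAbelianHodge)
    (hP : CMPointedWeilFamiliesComponentCM R e₀ k δ) (hV : LocalVHCAtCM) : WeilClassesComponentCM R e₀ k δ :=
  weilClassesComponentCM_of_HC_CM_local hCM hP (localWeilVHCAtCMComponentCM_of_localVHCAtCM R e₀ k δ hV)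

/-- **G5′-CM — row W1′-CM-loc with the CM-pivot germ, NO `HC_CM`.** [cite: Deligne1982HodgeCycles, §5] -/
theorem weilClassesComponentCM_of_divisorGeneratedCMPointed_of_localVHCAtCM
    (hP : DivisorGeneratedCMPointedWeilFamiliesComponentCM R e₀ k δ) (hV : LocalVHCAtCM) :
    WeilClassesComponentCM R e₀ k δ :=
  weilClassesComponentCM_of_divisorGeneratedCMPointed_localCM hP
    (localWeilVHCAtCMComponentCM_of_localVHCAtCM R e₀ k δ hV)

end CMFieldRows

/-- **G6 — HC(dim ≤ 5) from `HC_CM`**, CM-pointed Weil families, the CM-pivot germ and Moonen–Zarhin (part II's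
dim-≤-5 row with the germ leaf dominated; `HC_CM` nominal). [cite: MoonenZarhin1999, Thm. (dim ≤ 5)]
[cite: vanGeemen1994HodgeAV, Lemma 5.2] -/
theorem hc_dimLeFive_of_hc_cm_of_cmPointedQuadratic_of_localVHCAtCM (hCM : Theses.RankFourFaces.CMAbelianHodge)
    (hF : Ring2Transport.CMPointedWeilFamiliesQuadratic) (hV : LocalVHCAtCM)
    (hMZ : MoonenZarhin1999_hodgeClasses_abelian_dim_le_five_of_weilClassesFourfolds) :
    Theses.SevenfoldWeilCensus.HodgeAbelianDimLeFive :=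
  hc_dimLeFive_of_hc_cm_of_cmPointedQuadratic_of_localWeilVHCAtCM hCM hF
    (localWeilVHCAtCMQuadratic_of_localVHCAtCM hV) hMZ

end Summit.HodgeConjecture.HodgeConjecture.Ring2.Hypotheses

end
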